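import Literature.NumberTheory.Rogawski1990.ArchHCOrbitalFamilyGExt      -- ★ p850216 (LH3-p02 (g2)): `orbFamGExt` (+ ★ p850195 `hcExtendG`; ★ `ArchHCSpaceG`: `hcNrm`, `hcCayPt`, `HcSemireg`, `hcTwistedDeriv`)
import Literature.NumberTheory.Rogawski1990.ArchTransfFamilyWallGeometry  -- ★ p850239 (F0P3a-p09 (g5)) (GLUE-X-dress) B1: `exists_nhds_hcSemireg`, `mem_regG_of_offWall` (reused, not restated)
import HarnessLib

/-!
# (G′-EXT-DOCKS) Reading the wall-extended `G′`-family at a covered wall: off the wall it is the raw family germ-wise (so (I₃)'s left side is the raw one), the normal curve runs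
# in `RegG`, and the Cayley point is a wall point of the split chart where a `RegG`-limit of the raw family IS the value (Harish-Chandra ∕ Varadarajan 1977 I §1.12; Shelstad 1979 §4)

Topic `NumberTheory/Rogawski1990`; namespace `Literature.NumberTheory.Rogawski1990`.  THEOREMS ONLY (no definition, no instance, no notation, no axiom, no named fact, no `sorry`);
kernel lane `--kind proof --supports stmt-HodgeConjecture-24833`.  Cell `pub/hodgecm-mathlib`, crux H413 (`stmt-HodgeConjecture-24833`), F0∕P3c line LH3 (closer stub `stub_N9`,
DIRECT ROAD `F0_P3c_StubN9Direct`): sequel of (G′-EXT) (LH3-plan (g3) RULING #3 ∕ (J-CENSUS) of LH4-p03 (g4)); LH3-p02 (g2).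

THE POINT.  After the repair R1′ the letter L1 and organ J speak about ★ `orbFamGExt ν′ a′ = hcExtendG (slotSign L α) S′ (orbFamG ν′ a′ S′)`.  The consumers ((K0±)∕(J-DESC) on the
jump side, (A0-b)∕D4b on the Cayley side, the J head) compute with the RAW data `archRG · chartOrbG`.  This file says where those computations land:
* §1 OFF THE WALLS THE EXTENSION IS THE RAW FUNCTION GERM-WISE (`RegG S′` is open, ★ `isOpen_regG`): `hcExtendG_eventuallyEq_of_mem_regG`, hence equal twisted iterated derivatives
  there (`hcTwistedDeriv_congr_of_eventuallyEq`, Mathlib `Filter.EventuallyEq.iteratedFDeriv`; `hcTwistedDeriv_hcExtendG_of_mem_regG`) and the same smoothness on `RegG S′`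
  (`contDiffOn_hcExtendG_regG_iff`).
* §2 THE NORMAL CURVE OF A SEMIREGULAR WALL POINT RUNS IN `RegG S′` FOR SMALL `ν ≠ 0` (`eventually_add_smul_hcNrm_mem_regG`, over ★ B1 `exists_nhds_hcSemireg` ∕
  `mem_regG_of_offWall` of F0P3a-p09 (g5): the curve stays in the small neighbourhood and is off the wall for `ν ≠ 0`), so **the one-sided limits ∕ jumps of the twisted derivatives along the normal are the same for `hcExtendG s S′ g` and
  for `g`** (`hasOneSidedJump_hcTwistedDeriv_hcExtendG_iff`, over the generic `hasOneSidedJump_congr`): (I₃)'s LEFT side for the extended family is the raw one.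
* §3 THE CAYLEY POINT ★ `hcCayPt w i j p` (`x_w := 0`) is NOT in `RegG (insert w S′)` but IS in `InRegG s (insert w S′)` for a semiregular `p` (no sign hypothesis: `InRegG` has no
  condition at the now-split `w`), so **a `RegG`-limit of the raw function there IS the extended value** (`hcExtendG_insert_hcCayPt_eq_of_tendsto`, over ★ `hcExtendG_eq_of_tendsto`):
  (I₃)'s RIGHT side for the extended family reads the limit the descent computes.
* §4 the same for the genuine family: `orbFamGExt_eventuallyEq_orbFamG_of_mem_regG`, **`hasOneSidedJump_hcTwistedDeriv_orbFamGExt_iff`**, **`orbFamGExt_insert_hcCayPt_eq_of_tendsto`**.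
* §5 (ED. 2) the one-sided existence conjunct of (I₁) is implied by (I₃) (`archHcSmoothOneSided_of_smoothBounded_of_jump`, `archHCSpaceG_iff_smoothBounded_and_jump`); hence
  **`archHCSpaceG_orbFamGExt_iff_smoothBounded_and_jump`**: L1 for the extended genuine family = «`C^∞` on `InRegG` with bounded derivatives» ∧ (I₃), nothing else.
HONEST LABEL: HC_CM is proved only modulo the 7 printed citations (2 remaining: hLiu418 = `stmt-HodgeConjecture-24832`, h413 = `stmt-HodgeConjecture-24833`) until rung 0 closes;
count-neutral (reading lemmas; no limit is asserted to exist here).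

## References
* [Varadarajan1977] V. S. Varadarajan, *Harmonic Analysis on Real Reductive Groups*, LNM 576 (1977), Part I §1.12.
* [Shelstad1979] D. Shelstad, *Characters and inner forms of a quasi-split group over ℝ*, Compositio Math. 39 (1979), §4 pp. 22–25 (semiregular points, Lemma 4.3, Prop. 4.5).
* [Bouaziz1994IntegralesOrbitales] A. Bouaziz, *Intégrales orbitales sur les groupes de Lie réductifs*, Ann. Sci. ÉNS 27 (1994), §3.1–3.2 pp. 579–580 ((I₂), (I₃)).
-/

set_option autoImplicit false

noncomputable section

open MeasureTheory MeasureTheory.Measure NumberField NumberField.InfinitePlace Matrix Complex Set Filter Topology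
open scoped MatrixGroups Matrix Real ContDiff
open Literature.NumberTheory.Automorphic Literature.NumberTheory.Automorphic.UnitaryGroup Literature.NumberTheory.Automorphic.ArchCartan
open Literature.NumberTheory.Automorphic.Shelstad1979.StableOrbitalIntegrals
open Literature.NumberTheory.GaloisRepresentations

namespace Literature.NumberTheory.Rogawski1990

variable {W : Type*}

/-! ## §1 Off the walls: the extension is the raw function, germ-wise -/

section Germ

variable [Fintype W] [DecidableEq W] (s : W → Fin 3 → SignType) (S' : Finset W) (g : (W → Fin 3 → ℝ) → ℂ)

omit [DecidableEq W] in
/-- **At a `G`-regular point `hcExtendG s S′ g` and `g` agree on a neighbourhood** (★ `RegG S′` is open). [cite: Shelstad1979, §4 p. 22] -/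
theorem hcExtendG_eventuallyEq_of_mem_regG {c : W → Fin 3 → ℝ} (hc : c ∈ RegG S') : hcExtendG s S' g =ᶠ[𝓝 c] g :=
  Filter.eventuallyEq_of_mem ((isOpen_regG S').mem_nhds hc) (hcExtendG_eqOn_regG s S' g)

/-- Germ-equal families have the same twisted iterated derivatives at the point (Mathlib `Filter.EventuallyEq.iteratedFDeriv`). [cite: Bouaziz1994IntegralesOrbitales, §3.2 (I₃) p. 580] -/
theorem hcTwistedDeriv_congr_of_eventuallyEq {F G : (W → Fin 3 → ℝ) → ℂ} {c : W → Fin 3 → ℝ} (h : F =ᶠ[𝓝 c] G) (n : ℕ) (dirs : Fin n → (W → Fin 3 → ℝ)) :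
    hcTwistedDeriv S' n dirs F c = hcTwistedDeriv S' n dirs G c := by
  have h' : (fun c => archERhoG S' c * F c) =ᶠ[𝓝 c] fun c => archERhoG S' c * G c := by
    filter_upwards [h] with x hx
    rw [hx]
  unfold hcTwistedDeriv
  rw [(Filter.EventuallyEq.iteratedFDeriv ℝ h' n).eq_of_nhds]

/-- At a `G`-regular point the twisted iterated derivatives of the extension are those of the raw function. [cite: Varadarajan1977, I §1.12] -/
theorem hcTwistedDeriv_hcExtendG_of_mem_regG {c : W → Fin 3 → ℝ} (hc : c ∈ RegG S') (n : ℕ) (dirs : Fin n → (W → Fin 3 → ℝ)) :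
    hcTwistedDeriv S' n dirs (hcExtendG s S' g) c = hcTwistedDeriv S' n dirs g c :=
  hcTwistedDeriv_congr_of_eventuallyEq S' (hcExtendG_eventuallyEq_of_mem_regG s S' g hc) n dirs

omit [DecidableEq W] in
/-- Smoothness on `RegG S′` is the same for the extension and the raw function. [cite: Bouaziz1994IntegralesOrbitales, §3.1 (I₁) p. 579] -/
theorem contDiffOn_hcExtendG_regG_iff {n : WithTop ℕ∞} : ContDiffOn ℝ n (hcExtendG s S' g) (RegG S') ↔ ContDiffOn ℝ n g (RegG S') :=
  contDiffOn_congr (hcExtendG_eqOn_regG s S' g)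

end Germ

/-! ## §2 The normal curve of a semiregular wall point runs in `RegG` -/

section Normal

variable [Fintype W] [DecidableEq W]

omit [Fintype W] in
/-- Coordinates of the normal curve at the place `w`: `θ_i + ν`, `θ_j − ν`, the third angle unchanged. [cite: Shelstad1979, §4 p. 25] -/
theorem add_smul_hcNrm_apply_self (p : W → Fin 3 → ℝ) (ν : ℝ) (w : W) (i j : Fin 3) (l : Fin 3) :
    (p + ν • hcNrm w i j) w l = p w l + ν * ((if l = i then 1 else 0) - (if l = j then 1 else 0)) := by
  simp only [hcNrm, Pi.add_apply, Pi.smul_apply, Pi.single_eq_same, Pi.sub_apply, smul_eq_mul, Pi.single_apply]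

omit [Fintype W] in
/-- The normal curve does not move the other places. [cite: Shelstad1979, §4 p. 25] -/
theorem add_smul_hcNrm_apply_of_ne (p : W → Fin 3 → ℝ) (ν : ℝ) {w w' : W} (h : w' ≠ w) (i j : Fin 3) : (p + ν • hcNrm w i j) w' = p w' := by
  funext l
  simp only [hcNrm, Pi.add_apply, Pi.smul_apply, Pi.single_eq_of_ne h, Pi.zero_apply, smul_zero, add_zero]

omit [Fintype W] in
/-- The normal curve is continuous and passes through `p` at `ν = 0`. [cite: Shelstad1979, §4 p. 25] -/
theorem tendsto_add_smul_hcNrm (p : W → Fin 3 → ℝ) (w : W) (i j : Fin 3) : Tendsto (fun ν : ℝ => p + ν • hcNrm w i j) (𝓝 0) (𝓝 p) := by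
  have hc : Continuous fun ν : ℝ => p + ν • hcNrm w i j := continuous_const.add (continuous_id.smul continuous_const)
  simpa only [zero_smul, add_zero] using hc.tendsto 0

/-- **THE NORMAL CURVE RUNS IN `RegG S′` FOR SMALL `ν ≠ 0`**: at a semiregular point `p` of the wall `(w, i, j)` (`w ∉ S′`, `i ≠ j`), `p + ν • hcNrm w i j ∈ RegG S′` eventually along
`𝓝[≠] 0` — the curve stays in the small neighbourhood of ★ `exists_nhds_hcSemireg` and is OFF the wall for `ν ≠ 0` (`θ_i + ν ≠ θ_j − ν`), where ★ `mem_regG_of_offWall` applies.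
[cite: Shelstad1979, §4 p. 22] [cite: Varadarajan1977, I §1.12] -/
theorem eventually_add_smul_hcNrm_mem_regG {S' : Finset W} {w : W} (hw : w ∉ S') {i j : Fin 3} (hij : i ≠ j) {p : W → Fin 3 → ℝ} (hp : HcSemireg S' w i j p) :
    ∀ᶠ ν in 𝓝[≠] (0 : ℝ), p + ν • hcNrm w i j ∈ RegG S' := by
  obtain ⟨U, hUo, hpU, -, hU1, hU2, hU3, hU4⟩ := exists_nhds_hcSemireg hw hij hp
  have hmem : ∀ᶠ ν : ℝ in 𝓝 0, p + ν • hcNrm w i j ∈ U := tendsto_add_smul_hcNrm p w i j (hUo.mem_nhds hpU)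
  have hne : ∀ᶠ ν : ℝ in 𝓝[≠] 0, ν ∈ ({0} : Set ℝ)ᶜ := eventually_mem_nhdsWithin
  filter_upwards [hne, mem_nhdsWithin_of_mem_nhds hmem] with ν hν0 hνU
  rw [Set.mem_compl_singleton_iff] at hν0
  refine mem_regG_of_offWall hij (hU1 _ hνU) (hU2 _ hνU) (hU3 _ hνU) (hU4 _ hνU) ?_
  -- off the wall: `θ_i + ν ≠ θ_j − ν` for `ν ≠ 0`
  rw [add_smul_hcNrm_apply_self, add_smul_hcNrm_apply_self, if_pos rfl, if_neg hij, if_neg hij.symm, if_pos rfl, hp.1]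
  intro h
  apply hν0
  linarith

omit [Fintype W] [DecidableEq W] in
/-- **One-sided jumps at `0` only see the function on `𝓝[≠] 0`.** [cite: Shelstad1979, Prop. 4.5 (p. 26)] -/
theorem hasOneSidedJump_congr {F G : ℝ → ℂ} (h : F =ᶠ[𝓝[≠] (0 : ℝ)] G) (J : ℂ) : HasOneSidedJump F J ↔ HasOneSidedJump G J := by
  have hgt : F =ᶠ[𝓝[>] (0 : ℝ)] G := h.filter_mono (nhdsWithin_mono _ fun x (hx : 0 < x) => ne_of_gt hx)
  have hlt : F =ᶠ[𝓝[<] (0 : ℝ)] G := h.filter_mono (nhdsWithin_mono _ fun x (hx : x < 0) => ne_of_lt hx)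
  unfold HasOneSidedJump
  refine exists_congr fun Lp => exists_congr fun Lm => and_congr (Filter.tendsto_congr' hgt) (and_congr (Filter.tendsto_congr' hlt) Iff.rfl)

variable (s : W → Fin 3 → SignType)

/-- **(I₃)'s LEFT SIDE FOR THE EXTENSION IS THE RAW ONE**: along the normal of a semiregular wall point the twisted iterated derivatives of `hcExtendG s S′ g` and of `g` agree for small
`ν ≠ 0`, so they have the same one-sided limits and jumps. [cite: Shelstad1979, Prop. 4.5 (p. 26)] [cite: Varadarajan1977, I §1.12] [cite: Bouaziz1994IntegralesOrbitales, §3.2 (I₃) p. 580] -/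
theorem hcTwistedDeriv_hcExtendG_add_smul_hcNrm_eventuallyEq {S' : Finset W} {w : W} (hw : w ∉ S') {i j : Fin 3} (hij : i ≠ j) {p : W → Fin 3 → ℝ} (hp : HcSemireg S' w i j p)
    (g : (W → Fin 3 → ℝ) → ℂ) (n : ℕ) (dirs : Fin n → (W → Fin 3 → ℝ)) :
    (fun ν : ℝ => hcTwistedDeriv S' n dirs (hcExtendG s S' g) (p + ν • hcNrm w i j)) =ᶠ[𝓝[≠] (0 : ℝ)]
      fun ν : ℝ => hcTwistedDeriv S' n dirs g (p + ν • hcNrm w i j) := by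
  filter_upwards [eventually_add_smul_hcNrm_mem_regG hw hij hp] with ν hν
  exact hcTwistedDeriv_hcExtendG_of_mem_regG s S' g hν n dirs

/-- The jump form: `HasOneSidedJump` of the twisted derivatives along the normal is the same for `hcExtendG s S′ g` and `g`. [cite: Shelstad1979, Prop. 4.5 (p. 26)]
[cite: Bouaziz1994IntegralesOrbitales, §3.2 (I₃) p. 580] -/
theorem hasOneSidedJump_hcTwistedDeriv_hcExtendG_iff {S' : Finset W} {w : W} (hw : w ∉ S') {i j : Fin 3} (hij : i ≠ j) {p : W → Fin 3 → ℝ} (hp : HcSemireg S' w i j p)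
    (g : (W → Fin 3 → ℝ) → ℂ) (n : ℕ) (dirs : Fin n → (W → Fin 3 → ℝ)) (J : ℂ) :
    HasOneSidedJump (fun ν : ℝ => hcTwistedDeriv S' n dirs (hcExtendG s S' g) (p + ν • hcNrm w i j)) J ↔
      HasOneSidedJump (fun ν : ℝ => hcTwistedDeriv S' n dirs g (p + ν • hcNrm w i j)) J :=
  hasOneSidedJump_congr (hcTwistedDeriv_hcExtendG_add_smul_hcNrm_eventuallyEq s hw hij hp g n dirs) J

end Normal

/-! ## §3 The Cayley point is a wall point of the split chart -/

section Cayley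

variable [DecidableEq W] (s : W → Fin 3 → SignType)

omit [DecidableEq W] in
/-- The Cayley point is NOT `G`-regular on the split chart `insert w S′` (`x_w = 0`). [cite: Shelstad1979, §4 p. 25] -/
theorem hcCayPt_not_mem_regG_insert [DecidableEq W] (S' : Finset W) (w : W) (i j : Fin 3) (p : W → Fin 3 → ℝ) : hcCayPt w i j p ∉ RegG (insert w S') := by
  intro h
  exact (mem_regG_iff _ _).1 h |>.2 w (Finset.mem_insert_self w S') (hcCayPt_apply_self_zero w i j p)

/-- **The Cayley point of a semiregular wall point lies in `InRegG s (insert w S′)`** — `InRegG` has no condition at the now-split place `w`, and at the other compact places `p` is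
regular (no sign hypothesis needed). [cite: Shelstad1979, §4 p. 25] [cite: Bouaziz1994IntegralesOrbitales, §6.2 p. 591] -/
theorem hcCayPt_mem_inRegG_insert {S' : Finset W} {w : W} {i j : Fin 3} {p : W → Fin 3 → ℝ} (hp : HcSemireg S' w i j p) :
    hcCayPt w i j p ∈ InRegG s (insert w S') := by
  intro w' hw' a b hab _
  rw [Finset.mem_insert, not_or] at hw'
  rw [hcCayPt_apply_of_ne hw'.1]
  exact fun h => hab (hp.2.2.1 w' hw'.2 hw'.1 h)

/-- **A `RegG`-LIMIT OF THE RAW FUNCTION AT THE CAYLEY POINT IS THE EXTENDED VALUE THERE** (★ `hcExtendG_eq_of_tendsto` at a wall point of the split chart): the dock for the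
descent∕(A0-b)-type computations of (I₃)'s right side. [cite: Varadarajan1977, I §1.12] [cite: Bouaziz1994IntegralesOrbitales, §3.1 (I₂) p. 579] [cite: Shelstad1979, Lemma 4.3 (p. 25)] -/
theorem hcExtendG_insert_hcCayPt_eq_of_tendsto [Fintype W] {S' : Finset W} {w : W} {i j : Fin 3} {p : W → Fin 3 → ℝ} (hp : HcSemireg S' w i j p)
    (g : (W → Fin 3 → ℝ) → ℂ) {ℓ : ℂ} (h : Tendsto g (𝓝[RegG (insert w S')] (hcCayPt w i j p)) (𝓝 ℓ)) :
    hcExtendG s (insert w S') g (hcCayPt w i j p) = ℓ :=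
  hcExtendG_eq_of_tendsto s (insert w S') g (hcCayPt_mem_inRegG_insert s hp) (hcCayPt_not_mem_regG_insert S' w i j p) h

end Cayley

/-! ## §4 The genuine family -/

section Genuine

open scoped Classical

variable (L : Type) [Field L] [NumberField L] [IsCMField L] (α : Fin 3 → L)
  [MeasurableSpace ↥(arch (↥(maximalRealSubfield L)) L (IsCMField.complexConj L) 3 (Matrix.diagonal α))] [BorelSpace ↥(arch (↥(maximalRealSubfield L)) L (IsCMField.complexConj L) 3 (Matrix.diagonal α))]
  (ν' : Measure ↥(arch (↥(maximalRealSubfield L)) L (IsCMField.complexConj L) 3 (Matrix.diagonal α))) [IsFiniteMeasureOnCompacts ν'] [ν'.IsMulRightInvariant]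
  (a' : ↥(arch (↥(maximalRealSubfield L)) L (IsCMField.complexConj L) 3 (Matrix.diagonal α)) → ℂ)

/-- At a `G`-regular point the extended genuine family agrees with the raw one on a neighbourhood. [cite: Shelstad1979, §4 p. 22] -/
theorem orbFamGExt_eventuallyEq_orbFamG_of_mem_regG (S' : Finset {w : InfinitePlace L // IsComplex w}) {c : {w : InfinitePlace L // IsComplex w} → Fin 3 → ℝ} (hc : c ∈ RegG S') :
    orbFamGExt L α ν' a' S' =ᶠ[𝓝 c] orbFamG L α ν' a' S' :=
  hcExtendG_eventuallyEq_of_mem_regG _ S' _ hc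

/-- **(I₃)'s LEFT SIDE FOR `orbFamGExt` IS THE RAW ONE**: the jump of the twisted iterated derivatives along the normal of a semiregular wall point is the same for `orbFamGExt ν′ a′ S′`
and for `orbFamG ν′ a′ S′` — every (K0±)∕(J-DESC) computation made with `archRG · chartOrbG` transfers verbatim. [cite: Shelstad1979, Prop. 4.5 (p. 26)]
[cite: Bouaziz1994IntegralesOrbitales, §3.2 (I₃) p. 580] [cite: Varadarajan1977, I §1.12] -/
theorem hasOneSidedJump_hcTwistedDeriv_orbFamGExt_iff {S' : Finset {w : InfinitePlace L // IsComplex w}} {w : {w : InfinitePlace L // IsComplex w}} (hw : w ∉ S')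
    {i j : Fin 3} (hij : i ≠ j) {p : {w : InfinitePlace L // IsComplex w} → Fin 3 → ℝ} (hp : HcSemireg S' w i j p)
    (n : ℕ) (dirs : Fin n → ({w : InfinitePlace L // IsComplex w} → Fin 3 → ℝ)) (J : ℂ) :
    HasOneSidedJump (fun ν : ℝ => hcTwistedDeriv S' n dirs (orbFamGExt L α ν' a' S') (p + ν • hcNrm w i j)) J ↔
      HasOneSidedJump (fun ν : ℝ => hcTwistedDeriv S' n dirs (orbFamG L α ν' a' S') (p + ν • hcNrm w i j)) J :=
  hasOneSidedJump_hcTwistedDeriv_hcExtendG_iff (slotSign L α) hw hij hp _ n dirs J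

/-- **THE G′-SIDE CAYLEY DOCK**: at the Cayley point of a semiregular wall point, a `RegG (insert w S′)`-limit `ℓ` of the raw member `orbFamG ν′ a′ (insert w S′)` (= `archRG · chartOrbG`
on an admissible label) IS the value `orbFamGExt ν′ a′ (insert w S′) (hcCayPt w i j p)` — (I₃)'s right side for the extended genuine family reads the limit the descent computes.
[cite: Varadarajan1977, I §1.12] [cite: Shelstad1979, Lemma 4.3 (p. 25)] [cite: Bouaziz1994IntegralesOrbitales, §3.1 (I₂) p. 579] -/
theorem orbFamGExt_insert_hcCayPt_eq_of_tendsto {S' : Finset {w : InfinitePlace L // IsComplex w}} {w : {w : InfinitePlace L // IsComplex w}} {i j : Fin 3}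
    {p : {w : InfinitePlace L // IsComplex w} → Fin 3 → ℝ} (hp : HcSemireg S' w i j p) {ℓ : ℂ}
    (h : Tendsto (orbFamG L α ν' a' (insert w S')) (𝓝[RegG (insert w S')] (hcCayPt w i j p)) (𝓝 ℓ)) :
    orbFamGExt L α ν' a' (insert w S') (hcCayPt w i j p) = ℓ :=
  hcExtendG_insert_hcCayPt_eq_of_tendsto (slotSign L α) hp _ h

end Genuine

/-! ## §5 (ED. 2) The one-sided existence conjunct of (I₁) is implied by (I₃): L1 for the extended genuine family = «smooth-bounded on `T_{in-reg}`» ∧ (I₃) -/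

section Trim

variable [Fintype W] [DecidableEq W] {s : W → Fin 3 → SignType} {jc' : Finset W → W → Fin 3 → Fin 3 → ℂ} {F : Finset W → (W → Fin 3 → ℝ) → ℂ}

/-- **(I₁)+one-sided structure from «smooth-bounded» and (I₃)**: the third conjunct of ★ `ArchHcSmoothOneSided` (existence of both one-sided limits of every twisted adapted
derivative at every semiregular noncompact-wall point) is exactly what ★ `ArchHcJump.exists_tendsto` delivers. [cite: Bouaziz1994IntegralesOrbitales, §3.1–3.2 pp. 579–580]
[cite: Shelstad1979, Thm. 4.7 (p. 31)] -/
theorem archHcSmoothOneSided_of_smoothBounded_of_jump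
    (h1 : ∀ S' : Finset W, ContDiffOn ℝ ∞ (F S') (InRegG s S') ∧
      ∀ (n : ℕ) (K : Set (W → Fin 3 → ℝ)), IsCompact K → BddAbove ((fun c => ‖iteratedFDeriv ℝ n (F S') c‖) '' (K ∩ InRegG s S')))
    (hJ : ArchHcJump s jc' F) : ArchHcSmoothOneSided s F :=
  fun S' => ⟨(h1 S').1, (h1 S').2, fun _ hw _ _ hij hs _ hp n m => hJ.exists_tendsto hw hij hs hp n m⟩

/-- The «smooth-bounded» part of (I₁). [cite: Bouaziz1994IntegralesOrbitales, §3.1 p. 579] -/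
theorem ArchHcSmoothOneSided.smoothBounded (h : ArchHcSmoothOneSided s F) (S' : Finset W) :
    ContDiffOn ℝ ∞ (F S') (InRegG s S') ∧
      ∀ (n : ℕ) (K : Set (W → Fin 3 → ℝ)), IsCompact K → BddAbove ((fun c => ‖iteratedFDeriv ℝ n (F S') c‖) '' (K ∩ InRegG s S')) :=
  ⟨(h S').1, (h S').2.1⟩

/-- **`ArchHCSpaceG s jc′ F` ⟺ (P) ∧ (W) ∧ «smooth-bounded on `InRegG`» ∧ (I₄) ∧ (I₃)** — the one-sided existence clause is redundant given (I₃). [cite: Bouaziz1994IntegralesOrbitales, §3.2 p. 580] -/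
theorem archHCSpaceG_iff_smoothBounded_and_jump (s : W → Fin 3 → SignType) (jc' : Finset W → W → Fin 3 → Fin 3 → ℂ) (F : Finset W → (W → Fin 3 → ℝ) → ℂ) :
    ArchHCSpaceG s jc' F ↔
      ArchHcPeriodic F ∧ ArchHcWeyl s F ∧
        (∀ S' : Finset W, ContDiffOn ℝ ∞ (F S') (InRegG s S') ∧
          ∀ (n : ℕ) (K : Set (W → Fin 3 → ℝ)), IsCompact K → BddAbove ((fun c => ‖iteratedFDeriv ℝ n (F S') c‖) '' (K ∩ InRegG s S'))) ∧
        ArchHcCompactSupport F ∧ ArchHcJump s jc' F :=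
  ⟨fun h => ⟨h.1, h.2.1, fun S' => h.2.2.1.smoothBounded S', h.2.2.2.1, h.2.2.2.2⟩,
    fun h => ⟨h.1, h.2.1, archHcSmoothOneSided_of_smoothBounded_of_jump h.2.2.1 h.2.2.2.2, h.2.2.2.1, h.2.2.2.2⟩⟩

end Trim

section TrimGenuine

open scoped Classical

variable (L : Type) [Field L] [NumberField L] [IsCMField L] (α : Fin 3 → L)
  [MeasurableSpace ↥(arch (↥(maximalRealSubfield L)) L (IsCMField.complexConj L) 3 (Matrix.diagonal α))] [BorelSpace ↥(arch (↥(maximalRealSubfield L)) L (IsCMField.complexConj L) 3 (Matrix.diagonal α))]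
  (ν' : Measure ↥(arch (↥(maximalRealSubfield L)) L (IsCMField.complexConj L) 3 (Matrix.diagonal α))) [ν'.IsHaarMeasure] [ν'.IsMulRightInvariant]

/-- **LETTER L1 FOR THE EXTENDED GENUINE FAMILY, TRIMMED**: `orbFamGExt ν′ a′ ∈ ArchHCSpaceG (slotSign L α) jc′` iff (I₁)+(I₂) «`orbFamGExt … S′` is `C^∞` on `InRegG (slotSign L α) S′`
with bounded derivatives near the walls, for every `S′`» and (I₃) `ArchHcJump (slotSign L α) jc′ (orbFamGExt …)` — (P), (W), (I₄) are theorems (★ p850216) and the one-sided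
existence clause follows from (I₃).  This is the exact print content of Harish-Chandra's theorem the letter cites [Varadarajan1977, I §1.12; Bouaziz 1994 Thm. 3.2.1 «`J_G(φ) ∈ I(U)`»].
[cite: Varadarajan1977, I §1.12] [cite: Bouaziz1994IntegralesOrbitales, §3.2 p. 580] [cite: Shelstad1979, Thm. 4.7 (p. 31)] -/
theorem archHCSpaceG_orbFamGExt_iff_smoothBounded_and_jump (hα : ∀ i, α i ≠ 0) (hreal : ∀ (w : {w : InfinitePlace L // IsComplex w}) (k : Fin 3), (w.1.embedding (α k)).im = 0)
    {a' : ↥(arch (↥(maximalRealSubfield L)) L (IsCMField.complexConj L) 3 (Matrix.diagonal α)) → ℂ} (hc' : HasCompactSupport a') (jc' : Finset {w : InfinitePlace L // IsComplex w} → {w : InfinitePlace L // IsComplex w} → Fin 3 → Fin 3 → ℂ) :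
    ArchHCSpaceG (slotSign L α) jc' (orbFamGExt L α ν' a') ↔
      (∀ S' : Finset {w : InfinitePlace L // IsComplex w}, ContDiffOn ℝ ∞ (orbFamGExt L α ν' a' S') (InRegG (slotSign L α) S') ∧
          ∀ (n : ℕ) (K : Set ({w : InfinitePlace L // IsComplex w} → Fin 3 → ℝ)), IsCompact K →
            BddAbove ((fun c => ‖iteratedFDeriv ℝ n (orbFamGExt L α ν' a' S') c‖) '' (K ∩ InRegG (slotSign L α) S'))) ∧
        ArchHcJump (slotSign L α) jc' (orbFamGExt L α ν' a') := by
  rw [archHCSpaceG_orbFamGExt_iff L α ν' hα hreal hc' jc']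
  exact ⟨fun h => ⟨fun S' => h.1.smoothBounded S', h.2⟩, fun h => ⟨archHcSmoothOneSided_of_smoothBounded_of_jump h.1 h.2, h.2⟩⟩

end TrimGenuine

end Literature.NumberTheory.Rogawski1990

end
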